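import Literature.AnabelianGeometry.EtaleTheta.Discharge.Sec3CuspidallyPureZTower
import Literature.AnabelianGeometry.EtaleTheta.Discharge.Sec3Example39ivFactsAtGenuineBase
import Literature.AnabelianGeometry.EtaleTheta.Discharge.Sec3NonDilatingOfPfImage

/-!
# [EtTh] Example 3.9 (iv) «of rationally standard type over the slim base category `D_α` of FSM-type» (F-0616) at the Example 3.9 datum with (iii) := the ℤ-tower's / the `Ÿ`-skeleton's `Φ` (p. 311 / PDF p. 85)

S. Mochizuki, *The étale theta function and its Frobenioid-theoretic manifestations*, Publ. RIMS **45** (2009)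
[cite: MochizukiEtTh2009, Ex 3.9 (iv) p.311 (PDF p.85); Rmk 3.7.2 p.306 (PDF p.80)]: Example 3.9 (iv) «one obtains … a tempered Frobenioid …
of rationally standard type over the slim base category `D_α` … of FSM-type».

PROOF-ONLY companion (no `def`, no instance, no new named fact).  abc-iut cell, layer L2, seat abc-iut-w6-d047 (gen 4), abc-iut-L2-lead (gen 7)
R930 «(x2)» after «ZTOWER-CUSP-PURE» (p485844 / p486418).  FACT-LIST row **F-0616** `Example39Data.Example39_iv_facts E α h :=
(Φ_α^ell rational) ∧ IsSlim D_α ∧ IsOfFSMType D_α` is `parametrised` with REFUTED universal closure; abc-iut-w6-d053's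
`Example39Data.example39_iv_facts_bTemp` (p-landed) produces it over every genuine base `B^temp(W^log)⁰` ⟸ the rationality clause `hrat`
(Rmk. 3.7.2 supplies «slim» and «FSM-type»).  THIS FILE instantiates that at the two MULTI-PRIME Example 3.9 data of this seat's
`Discharge/Sec3CuspidallyPureZTower.lean`:
* `ZTowerTempered.example39_iv_facts_ofInducedSquare` — F-0616 at the Example 3.9 datum over `B^temp(Π^tp_X)⁰` with (iii) := the ℤ-tower's `Φ`
  ⟸ `hrat` (any category vocabulary `treeCatVocab D_α Rα Sα`); `…_ofInducedSquare_trivialVocab` — CLOSED (no binder) at the vocabulary whose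
  rationality predicate is `⊤`;
* `ThetaTowerTempered.example39_iv_facts_ofInducedSquare` / `…_trivialVocab` — the same at abc-iut-L2-t3's `Ÿ`-skeleton with cusps ⟸ the displayed
  non-dilating binder `hnd` of the parent file;
* `ThetaCovers.TemperedCoverData.example39_iv_facts_dotC_ofRankOneObject` (§3, appended; abc-iut-L2-lead R916 «(x2) at the Ċ-datum») — F-0616 at
  the TEXT's Example 3.9 (i) instance `X = Ċ` over `B^temp(Π^tp_Ċ)⁰` (datum of p483876) ⟸ {`hrat`, `Π^tp_Ċ` temp-slim} («tempered» is
  inherited by the closed subgroup `Π^tp_Ċ ⊆ Π^tp_C`).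
* `ThetaTowerTempered.example39_iv_facts_ofInducedSquare_closed` (§4, appended once abc-iut-f-128's `ThetaTowerTempered.isNonDilating_pull`,
  p486716, landed) — the `hnd` binder of §2 DISCHARGED BY NAME: F-0616 with NO binder at the `Ÿ`-skeleton datum in the ⊤-rationality vocabulary.
HONEST LABEL: the tree has no [FrdI] Def. 4.5 (iii) «rationally standard» vocabulary yet — `treeCatVocab D R S` carries the rationality PREDICATE
as a free parameter, so the `_trivialVocab` instances discharge «rational» VACUOUSLY (vocabulary-level), exactly as the models of record
(`ofRankOneObjectConnectedPart … (fun _ => True) (fun _ => True)`) do; the content here is «slim» + «FSM-type» at the genuine base (Rmk. 3.7.2,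
abc-iut-L2-t10) and the fact that the Example 3.9 datum is a CONSTRUCTED multi-prime one.  Nothing here bears on [IUTchIII] Cor. 3.12;
typed ≠ proved; no side taken. [claim: MochizukiEtTh2009, status: refereed pre-IUT]
-/

noncomputable section

namespace Literature.AnabelianGeometry.EtaleTheta

open CategoryTheory Opposite Function Literature.AlgebraicGeometry.Frobenioids Literature.AlgebraicGeometry.Frobenioids.QuasiTemperoid
  Literature.AnabelianGeometry.SemiGraphs Literature.AlgebraicGeometry.Frobenioids.QuasiTemperoid.BTempConnected

/-! ### §1. At the ℤ-tower datum -/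

namespace ZTowerTempered

open LogDivisorModel

variable {K : Type} [Field K] (X : SemiGraphs.TemperedArithmeticGroup.{0} K) (φ : X.Pi →* Multiplicative ℤ)
  (R S : ((ConnectedPart (BTemp X.Pi))ᵒᵖ ⥤ CommMonCat.{0}) → Prop)
  {GU GX GY : Type} [Group GU] [TopologicalSpace GU]
  [Group GX] [TopologicalSpace GX] [IsTopologicalGroup GX] [Group GY] [TopologicalSpace GY] [IsTopologicalGroup GY]
  (iUX : GU →* GX) (iUY : GU →* GY) (iXW : GX →* X.Pi) (iYW : GY →* X.Pi)
  (hUX : IsOpenMap iUX) (hUY : IsOpenMap iUY) (hXW : IsOpenMap iXW) (hYW : IsOpenMap iYW)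
  (cUX : Continuous iUX) (cUY : Continuous iUY) (cXW : Continuous iXW) (cYW : Continuous iYW)
  (hQX : ∀ V : Subgroup GX, IsOpen (V : Set GX) → Countable (GX ⧸ V))
  (hQY : ∀ V : Subgroup GY, IsOpen (V : Set GY) → Countable (GY ⧸ V))
  (hQW : ∀ V : Subgroup X.Pi, IsOpen (V : Set X.Pi) → Countable (X.Pi ⧸ V))
  (hsq : iXW.comp iUX = iYW.comp iUY)
  (ellY : ObjectProperty (ConnectedPart (BTemp GY)))
  (toEllY : ConnectedPart (BTemp GY) ⥤ ellY.FullSubcategory) (adjY : toEllY ⊣ ellY.ι)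
  (ellW : ObjectProperty (ConnectedPart (BTemp X.Pi)))
  (toEllW : ConnectedPart (BTemp X.Pi) ⥤ ellW.FullSubcategory) (adjW : toEllW ⊣ ellW.ι)
  {A B : ConnectedPart (BTemp X.Pi)} (α : A ⟶ B)

/-- **Example 3.9 (iv) «rationally standard over the slim base category `D_α` of FSM-type» (F-0616) at the Example 3.9 datum with (iii) := the
ℤ-tower's `Φ`, ⟸ the rationality clause** («slim», «FSM-type» by Rmk. 3.7.2 at the genuine base — abc-iut-w6-d053's `example39_iv_facts_bTemp`).
[cite: MochizukiEtTh2009, Ex 3.9 (iv) p.311 (PDF p.85); Rmk 3.7.2 p.306 (PDF p.80)] -/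
theorem example39_iv_facts_ofInducedSquare (IsRationalα IsStrictlyRationalα : ((Example39Data.Dα α)ᵒᵖ ⥤ CommMonCat.{0}) → Prop)
    (hrat : ((Example39Data.ofInducedSquare iUX iUY iXW iYW hUX hUY hXW hYW cUX cUY cXW cYW hQX hQY hQW hsq treeMonoidVocabWeak.{0}
      ((RealifiedDivisorMonoids.ofRlfZWeak (dm X φ) (hpf X φ)).precomp (temperedFrobenioid X φ R S).base) ellY toEllY adjY ellW
      toEllW adjW (temperedFrobenioid X φ R S).Φ (hP X φ R S) (temperedFrobenioid X φ R S).isGroupSaturated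
      (temperedFrobenioid X φ R S).isPerfFactorial (isNonDilating X φ R S)).thetaFrobenioid α
      (Example39Data.frobenioidHyp_ofInducedSquare_ofTempered iUX iUY iXW iYW hUX hUY hXW hYW cUX cUY cXW cYW hQX hQY hQW hsq ellY
        toEllY adjY ellW toEllW adjW (temperedFrobenioid X φ R S) (hP X φ R S) (isNonDilating X φ R S) α IsRationalα
        IsStrictlyRationalα)).IsRational) :
    (Example39Data.ofInducedSquare iUX iUY iXW iYW hUX hUY hXW hYW cUX cUY cXW cYW hQX hQY hQW hsq treeMonoidVocabWeak.{0}
      ((RealifiedDivisorMonoids.ofRlfZWeak (dm X φ) (hpf X φ)).precomp (temperedFrobenioid X φ R S).base) ellY toEllY adjY ellW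
      toEllW adjW (temperedFrobenioid X φ R S).Φ (hP X φ R S) (temperedFrobenioid X φ R S).isGroupSaturated
      (temperedFrobenioid X φ R S).isPerfFactorial (isNonDilating X φ R S)).Example39_iv_facts α
      (Example39Data.frobenioidHyp_ofInducedSquare_ofTempered iUX iUY iXW iYW hUX hUY hXW hYW cUX cUY cXW cYW hQX hQY hQW hsq ellY
        toEllY adjY ellW toEllW adjW (temperedFrobenioid X φ R S) (hP X φ R S) (isNonDilating X φ R S) α IsRationalα
        IsStrictlyRationalα) :=
  Example39Data.example39_iv_facts_bTemp X _ α _ hrat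

/-- **F-0616 CLOSED at the ℤ-tower Example 3.9 datum in the category vocabulary whose rationality predicate is `⊤`** (honest: «rational» is then
vacuous — the tree has no [FrdI] Def. 4.5 vocabulary yet; «slim» and «FSM-type» are Rmk. 3.7.2 at the genuine base).
[cite: MochizukiEtTh2009, Ex 3.9 (iv) p.311 (PDF p.85); Rmk 3.7.2 p.306 (PDF p.80)] -/
theorem example39_iv_facts_ofInducedSquare_trivialVocab :
    (Example39Data.ofInducedSquare iUX iUY iXW iYW hUX hUY hXW hYW cUX cUY cXW cYW hQX hQY hQW hsq treeMonoidVocabWeak.{0}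
      ((RealifiedDivisorMonoids.ofRlfZWeak (dm X φ) (hpf X φ)).precomp (temperedFrobenioid X φ R S).base) ellY toEllY adjY ellW
      toEllW adjW (temperedFrobenioid X φ R S).Φ (hP X φ R S) (temperedFrobenioid X φ R S).isGroupSaturated
      (temperedFrobenioid X φ R S).isPerfFactorial (isNonDilating X φ R S)).Example39_iv_facts α
      (Example39Data.frobenioidHyp_ofInducedSquare_ofTempered iUX iUY iXW iYW hUX hUY hXW hYW cUX cUY cXW cYW hQX hQY hQW hsq ellY
        toEllY adjY ellW toEllW adjW (temperedFrobenioid X φ R S) (hP X φ R S) (isNonDilating X φ R S) α (fun _ => True)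
        (fun _ => True)) :=
  example39_iv_facts_ofInducedSquare X φ R S iUX iUY iXW iYW hUX hUY hXW hYW cUX cUY cXW cYW hQX hQY hQW hsq ellY toEllY adjY ellW
    toEllW adjW α _ _ trivial

end ZTowerTempered

/-! ### §2. At the `Ÿ`-skeleton with cusps (⟸ the non-dilating binder) -/

namespace ThetaTowerTempered

variable {K : Type} [Field K] (X : SemiGraphs.TemperedArithmeticGroup.{0} K) (φ : X.Pi →* Multiplicative ℤ)
  (R S : ((ConnectedPart (BTemp X.Pi))ᵒᵖ ⥤ CommMonCat.{0}) → Prop)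
  (hnd : ∀ (A : (ConnectedPart (BTemp X.Pi))ᵒᵖ) (f : A ⟶ A),
    treeMonoidVocabWeak.{0}.IsNonDilating ((temperedFrobenioid X φ R S).Φ.carrier A) ((temperedFrobenioid X φ R S).Φ.pull f))
  {GU GX GY : Type} [Group GU] [TopologicalSpace GU]
  [Group GX] [TopologicalSpace GX] [IsTopologicalGroup GX] [Group GY] [TopologicalSpace GY] [IsTopologicalGroup GY]
  (iUX : GU →* GX) (iUY : GU →* GY) (iXW : GX →* X.Pi) (iYW : GY →* X.Pi)
  (hUX : IsOpenMap iUX) (hUY : IsOpenMap iUY) (hXW : IsOpenMap iXW) (hYW : IsOpenMap iYW)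
  (cUX : Continuous iUX) (cUY : Continuous iUY) (cXW : Continuous iXW) (cYW : Continuous iYW)
  (hQX : ∀ V : Subgroup GX, IsOpen (V : Set GX) → Countable (GX ⧸ V))
  (hQY : ∀ V : Subgroup GY, IsOpen (V : Set GY) → Countable (GY ⧸ V))
  (hQW : ∀ V : Subgroup X.Pi, IsOpen (V : Set X.Pi) → Countable (X.Pi ⧸ V))
  (hsq : iXW.comp iUX = iYW.comp iUY)
  (ellY : ObjectProperty (ConnectedPart (BTemp GY)))
  (toEllY : ConnectedPart (BTemp GY) ⥤ ellY.FullSubcategory) (adjY : toEllY ⊣ ellY.ι)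
  (ellW : ObjectProperty (ConnectedPart (BTemp X.Pi)))
  (toEllW : ConnectedPart (BTemp X.Pi) ⥤ ellW.FullSubcategory) (adjW : toEllW ⊣ ellW.ι)
  {A B : ConnectedPart (BTemp X.Pi)} (α : A ⟶ B)

/-- **F-0616 at the Example 3.9 datum with (iii) := the `Φ` of the `Ÿ`-skeleton with cusps, ⟸ `hrat` and the non-dilating binder `hnd`.**
[cite: MochizukiEtTh2009, Ex 3.9 (iv) p.311 (PDF p.85); Rmk 3.7.2 p.306 (PDF p.80)] -/
theorem example39_iv_facts_ofInducedSquare (IsRationalα IsStrictlyRationalα : ((Example39Data.Dα α)ᵒᵖ ⥤ CommMonCat.{0}) → Prop)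
    (hrat : ((Example39Data.ofInducedSquare iUX iUY iXW iYW hUX hUY hXW hYW cUX cUY cXW cYW hQX hQY hQW hsq treeMonoidVocabWeak.{0}
      ((RealifiedDivisorMonoids.ofRlfZWeak (dm X φ) (hpf X φ)).precomp (temperedFrobenioid X φ R S).base) ellY toEllY adjY ellW
      toEllW adjW (temperedFrobenioid X φ R S).Φ (hP X φ R S) (temperedFrobenioid X φ R S).isGroupSaturated
      (temperedFrobenioid X φ R S).isPerfFactorial hnd).thetaFrobenioid α
      (Example39Data.frobenioidHyp_ofInducedSquare_ofTempered iUX iUY iXW iYW hUX hUY hXW hYW cUX cUY cXW cYW hQX hQY hQW hsq ellY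
        toEllY adjY ellW toEllW adjW (temperedFrobenioid X φ R S) (hP X φ R S) hnd α IsRationalα IsStrictlyRationalα)).IsRational) :
    (Example39Data.ofInducedSquare iUX iUY iXW iYW hUX hUY hXW hYW cUX cUY cXW cYW hQX hQY hQW hsq treeMonoidVocabWeak.{0}
      ((RealifiedDivisorMonoids.ofRlfZWeak (dm X φ) (hpf X φ)).precomp (temperedFrobenioid X φ R S).base) ellY toEllY adjY ellW
      toEllW adjW (temperedFrobenioid X φ R S).Φ (hP X φ R S) (temperedFrobenioid X φ R S).isGroupSaturated
      (temperedFrobenioid X φ R S).isPerfFactorial hnd).Example39_iv_facts α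
      (Example39Data.frobenioidHyp_ofInducedSquare_ofTempered iUX iUY iXW iYW hUX hUY hXW hYW cUX cUY cXW cYW hQX hQY hQW hsq ellY
        toEllY adjY ellW toEllW adjW (temperedFrobenioid X φ R S) (hP X φ R S) hnd α IsRationalα IsStrictlyRationalα) :=
  Example39Data.example39_iv_facts_bTemp X _ α _ hrat

/-- **F-0616 at the `Ÿ`-skeleton Example 3.9 datum in the vocabulary with rationality predicate `⊤`, ⟸ only the non-dilating binder `hnd`.**
[cite: MochizukiEtTh2009, Ex 3.9 (iv) p.311 (PDF p.85); Rmk 3.7.2 p.306 (PDF p.80)] -/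
theorem example39_iv_facts_ofInducedSquare_trivialVocab :
    (Example39Data.ofInducedSquare iUX iUY iXW iYW hUX hUY hXW hYW cUX cUY cXW cYW hQX hQY hQW hsq treeMonoidVocabWeak.{0}
      ((RealifiedDivisorMonoids.ofRlfZWeak (dm X φ) (hpf X φ)).precomp (temperedFrobenioid X φ R S).base) ellY toEllY adjY ellW
      toEllW adjW (temperedFrobenioid X φ R S).Φ (hP X φ R S) (temperedFrobenioid X φ R S).isGroupSaturated
      (temperedFrobenioid X φ R S).isPerfFactorial hnd).Example39_iv_facts α
      (Example39Data.frobenioidHyp_ofInducedSquare_ofTempered iUX iUY iXW iYW hUX hUY hXW hYW cUX cUY cXW cYW hQX hQY hQW hsq ellY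
        toEllY adjY ellW toEllW adjW (temperedFrobenioid X φ R S) (hP X φ R S) hnd α (fun _ => True) (fun _ => True)) :=
  example39_iv_facts_ofInducedSquare X φ R S hnd iUX iUY iXW iYW hUX hUY hXW hYW cUX cUY cXW cYW hQX hQY hQW hsq ellY toEllY adjY
    ellW toEllW adjW α _ _ trivial

end ThetaTowerTempered

/-! ### §3. At the text's instance `X = Ċ` (arrows `Ẋ → Ċ`) over `B^temp(Π^tp_Ċ)⁰`, (iii) := the rank-one engine (abc-iut-L2-lead R916 «(x2) at the Ċ-datum») -/

namespace ThetaCovers.TemperedCoverData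

open Example39BaseSquare

universe u₀ v₀

variable {l : ℕ} (T : TemperedCoverData.{0} l) (hT : IsTempered T.Gtp) (hZ : IsSlimGroup ↥T.PiCdot)
  {D₀ : Type u₀} [Category.{v₀} D₀] {dm : DivisorMonoids.{u₀, v₀, 0} D₀} (P : dm.RankOneObject)
  (hpf : ∀ Y : D₀ᵒᵖ, IsPerfFactorialCof (dm.Φ₀.obj Y)) (R S : ((Discrete PUnit.{1})ᵒᵖ ⥤ CommMonCat.{0}) → Prop)
  (R' S' : ((ConnectedPart (BTemp ↥T.PiCdot))ᵒᵖ ⥤ CommMonCat.{0}) → Prop)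
  {A B : ConnectedPart (BTemp ↥T.PiCdot)} (α : A ⟶ B)

include hT hZ in
/-- **F-0616 at the text's Example 3.9 (i) instance `X = Ċ` over `D_W = B^temp(Π^tp_Ċ)⁰`** (the datum of this seat's
`example39_iv_cuspidallyPure_dotC_ofRankOneObject`, p483876) ⟸ the rationality clause `hrat`: «slim» from Rmk. 3.7.2 at the open subgroup
`Π^tp_Ċ ⊆ Π^tp_C` (tempered as a closed subgroup of a tempered group, abc-iut-L3's `IsTempered.subgroup_of_isClosed`; temp-slim by the
hypothesis `hZ`), «FSM-type» by [FrdII] Ex. 1.3 (i). [cite: MochizukiEtTh2009, Ex 3.9 (iv) p.311 (PDF p.85); Rmk 3.7.2 p.306 (PDF p.80)] -/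
theorem example39_iv_facts_dotC_ofRankOneObject
    (IsRationalα IsStrictlyRationalα : ((Example39Data.Dα α)ᵒᵖ ⥤ CommMonCat.{0}) → Prop)
    (hrat : ((Example39Data.ofInducedSquare T.dotXToDotC (MonoidHom.id _) (MonoidHom.id _) T.dotXToDotC
      (isOpenMap_dotXToDotC T) IsOpenMap.id IsOpenMap.id (isOpenMap_dotXToDotC T)
      (continuous_dotXToDotC T) continuous_id continuous_id (continuous_dotXToDotC T)
      (countable_quotient_PiCdot T hT) (countable_quotient_dotX T hT) (countable_quotient_PiCdot T hT)
      (by rw [MonoidHom.id_comp, MonoidHom.comp_id]) treeMonoidVocabWeak.{0}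
      ((RealifiedDivisorMonoids.ofRlfZWeak dm hpf).precomp
        (TemperedFrobenioid.ofRankOneObjectConnectedPart P hpf R S ↥T.PiCdot R' S').base)
      ⊤ (ObjectProperty.topEquivalence _).inverse (ObjectProperty.topEquivalence _).symm.toAdjunction
      ⊤ (ObjectProperty.topEquivalence _).inverse (ObjectProperty.topEquivalence _).symm.toAdjunction
      (TemperedFrobenioid.ofRankOneObjectConnectedPart P hpf R S ↥T.PiCdot R' S').Φ
      (TemperedFrobenioid.isPerfect_Φ_ofRankOneObjectConnectedPart P hpf R S ↥T.PiCdot R' S')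
      (TemperedFrobenioid.ofRankOneObjectConnectedPart P hpf R S ↥T.PiCdot R' S').isGroupSaturated
      (TemperedFrobenioid.ofRankOneObjectConnectedPart P hpf R S ↥T.PiCdot R' S').isPerfFactorial
      (TemperedFrobenioid.isNonDilating_pull_ofRankOneObjectConnectedPart P hpf R S ↥T.PiCdot R' S')).thetaFrobenioid α
      (Example39Data.frobenioidHyp_ofInducedSquare_ofTempered T.dotXToDotC (MonoidHom.id _) (MonoidHom.id _) T.dotXToDotC
        (isOpenMap_dotXToDotC T) IsOpenMap.id IsOpenMap.id (isOpenMap_dotXToDotC T)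
        (continuous_dotXToDotC T) continuous_id continuous_id (continuous_dotXToDotC T)
        (countable_quotient_PiCdot T hT) (countable_quotient_dotX T hT) (countable_quotient_PiCdot T hT)
        (by rw [MonoidHom.id_comp, MonoidHom.comp_id])
        ⊤ (ObjectProperty.topEquivalence _).inverse (ObjectProperty.topEquivalence _).symm.toAdjunction
        ⊤ (ObjectProperty.topEquivalence _).inverse (ObjectProperty.topEquivalence _).symm.toAdjunction
        (TemperedFrobenioid.ofRankOneObjectConnectedPart P hpf R S ↥T.PiCdot R' S')
        (TemperedFrobenioid.isPerfect_Φ_ofRankOneObjectConnectedPart P hpf R S ↥T.PiCdot R' S')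
        (TemperedFrobenioid.isNonDilating_pull_ofRankOneObjectConnectedPart P hpf R S ↥T.PiCdot R' S') α IsRationalα
        IsStrictlyRationalα)).IsRational) :
    (Example39Data.ofInducedSquare T.dotXToDotC (MonoidHom.id _) (MonoidHom.id _) T.dotXToDotC
      (isOpenMap_dotXToDotC T) IsOpenMap.id IsOpenMap.id (isOpenMap_dotXToDotC T)
      (continuous_dotXToDotC T) continuous_id continuous_id (continuous_dotXToDotC T)
      (countable_quotient_PiCdot T hT) (countable_quotient_dotX T hT) (countable_quotient_PiCdot T hT)
      (by rw [MonoidHom.id_comp, MonoidHom.comp_id]) treeMonoidVocabWeak.{0}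
      ((RealifiedDivisorMonoids.ofRlfZWeak dm hpf).precomp
        (TemperedFrobenioid.ofRankOneObjectConnectedPart P hpf R S ↥T.PiCdot R' S').base)
      ⊤ (ObjectProperty.topEquivalence _).inverse (ObjectProperty.topEquivalence _).symm.toAdjunction
      ⊤ (ObjectProperty.topEquivalence _).inverse (ObjectProperty.topEquivalence _).symm.toAdjunction
      (TemperedFrobenioid.ofRankOneObjectConnectedPart P hpf R S ↥T.PiCdot R' S').Φ
      (TemperedFrobenioid.isPerfect_Φ_ofRankOneObjectConnectedPart P hpf R S ↥T.PiCdot R' S')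
      (TemperedFrobenioid.ofRankOneObjectConnectedPart P hpf R S ↥T.PiCdot R' S').isGroupSaturated
      (TemperedFrobenioid.ofRankOneObjectConnectedPart P hpf R S ↥T.PiCdot R' S').isPerfFactorial
      (TemperedFrobenioid.isNonDilating_pull_ofRankOneObjectConnectedPart P hpf R S ↥T.PiCdot R' S')).Example39_iv_facts α
      (Example39Data.frobenioidHyp_ofInducedSquare_ofTempered T.dotXToDotC (MonoidHom.id _) (MonoidHom.id _) T.dotXToDotC
        (isOpenMap_dotXToDotC T) IsOpenMap.id IsOpenMap.id (isOpenMap_dotXToDotC T)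
        (continuous_dotXToDotC T) continuous_id continuous_id (continuous_dotXToDotC T)
        (countable_quotient_PiCdot T hT) (countable_quotient_dotX T hT) (countable_quotient_PiCdot T hT)
        (by rw [MonoidHom.id_comp, MonoidHom.comp_id])
        ⊤ (ObjectProperty.topEquivalence _).inverse (ObjectProperty.topEquivalence _).symm.toAdjunction
        ⊤ (ObjectProperty.topEquivalence _).inverse (ObjectProperty.topEquivalence _).symm.toAdjunction
        (TemperedFrobenioid.ofRankOneObjectConnectedPart P hpf R S ↥T.PiCdot R' S')
        (TemperedFrobenioid.isPerfect_Φ_ofRankOneObjectConnectedPart P hpf R S ↥T.PiCdot R' S')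
        (TemperedFrobenioid.isNonDilating_pull_ofRankOneObjectConnectedPart P hpf R S ↥T.PiCdot R' S') α IsRationalα
        IsStrictlyRationalα) :=
  Example39Data.example39_iv_facts_of α _ _ hrat
    (isSlim_connectedPart_bTemp (hT.subgroup_of_isClosed T.PiCdot (T.PiCdot.isClosed_of_isOpen T.isOpen_PiCdot)) hZ)
    connectedPart_isOfFSMType

end ThetaCovers.TemperedCoverData

/-! ### §4. The `Ÿ`-skeleton binder discharged (abc-iut-f-128's `isNonDilating_pull`) -/

namespace ThetaTowerTempered

variable {K : Type} [Field K] (X : SemiGraphs.TemperedArithmeticGroup.{0} K) (φ : X.Pi →* Multiplicative ℤ)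
  (R S : ((ConnectedPart (BTemp X.Pi))ᵒᵖ ⥤ CommMonCat.{0}) → Prop)
  {GU GX GY : Type} [Group GU] [TopologicalSpace GU]
  [Group GX] [TopologicalSpace GX] [IsTopologicalGroup GX] [Group GY] [TopologicalSpace GY] [IsTopologicalGroup GY]
  (iUX : GU →* GX) (iUY : GU →* GY) (iXW : GX →* X.Pi) (iYW : GY →* X.Pi)
  (hUX : IsOpenMap iUX) (hUY : IsOpenMap iUY) (hXW : IsOpenMap iXW) (hYW : IsOpenMap iYW)
  (cUX : Continuous iUX) (cUY : Continuous iUY) (cXW : Continuous iXW) (cYW : Continuous iYW)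
  (hQX : ∀ V : Subgroup GX, IsOpen (V : Set GX) → Countable (GX ⧸ V))
  (hQY : ∀ V : Subgroup GY, IsOpen (V : Set GY) → Countable (GY ⧸ V))
  (hQW : ∀ V : Subgroup X.Pi, IsOpen (V : Set X.Pi) → Countable (X.Pi ⧸ V))
  (hsq : iXW.comp iUX = iYW.comp iUY)
  (ellY : ObjectProperty (ConnectedPart (BTemp GY)))
  (toEllY : ConnectedPart (BTemp GY) ⥤ ellY.FullSubcategory) (adjY : toEllY ⊣ ellY.ι)
  (ellW : ObjectProperty (ConnectedPart (BTemp X.Pi)))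
  (toEllW : ConnectedPart (BTemp X.Pi) ⥤ ellW.FullSubcategory) (adjW : toEllW ⊣ ellW.ι)
  {A B : ConnectedPart (BTemp X.Pi)} (α : A ⟶ B)

/-- **F-0616 with NO binder at the `Ÿ`-skeleton Example 3.9 datum** (⊤-rationality vocabulary; non-dilating by abc-iut-f-128's `isNonDilating_pull`).
[cite: MochizukiEtTh2009, Ex 3.9 (iv) p.311 (PDF p.85); Rmk 3.7.2 p.306 (PDF p.80)] -/
theorem example39_iv_facts_ofInducedSquare_closed :
    (Example39Data.ofInducedSquare iUX iUY iXW iYW hUX hUY hXW hYW cUX cUY cXW cYW hQX hQY hQW hsq treeMonoidVocabWeak.{0}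
      ((RealifiedDivisorMonoids.ofRlfZWeak (dm X φ) (hpf X φ)).precomp (temperedFrobenioid X φ R S).base) ellY toEllY adjY ellW
      toEllW adjW (temperedFrobenioid X φ R S).Φ (hP X φ R S) (temperedFrobenioid X φ R S).isGroupSaturated
      (temperedFrobenioid X φ R S).isPerfFactorial (isNonDilating_pull X φ R S)).Example39_iv_facts α
      (Example39Data.frobenioidHyp_ofInducedSquare_ofTempered iUX iUY iXW iYW hUX hUY hXW hYW cUX cUY cXW cYW hQX hQY hQW hsq ellY
        toEllY adjY ellW toEllW adjW (temperedFrobenioid X φ R S) (hP X φ R S) (isNonDilating_pull X φ R S) α (fun _ => True)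
        (fun _ => True)) :=
  example39_iv_facts_ofInducedSquare_trivialVocab X φ R S (isNonDilating_pull X φ R S) iUX iUY iXW iYW hUX hUY hXW hYW cUX cUY cXW
    cYW hQX hQY hQW hsq ellY toEllY adjY ellW toEllW adjW α

end ThetaTowerTempered

end Literature.AnabelianGeometry.EtaleTheta

end
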